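import Mathlib.RingTheory.LocalRing.Length
import Mathlib.RingTheory.TensorProduct.Quotient
import Mathlib.RingTheory.Derivation.Basic
import Mathlib.RingTheory.SimpleModule.Basic
import HarnessLib

/-!
# Crux `Steer` (stmt-ResolutionOfSingularities-16345), chain W4.1, K3ᴳ / ℓ-COMPARISON (RULING 281 (a), SPEC `K3G/JacobianLengthEtale_signature.lean`):
# the ALGEBRAIC CORE — absolute Jacobian colength does not grow along a FLAT UNRAMIFIED local extension along which derivations extend

OURS (campaign `res-hironaka`, rung L ★L-G4, slot W4.1; seat res-L0-w41-stub-2 g6). Theses-free, definition-free, Mathlib-only. For a flat local homomorphism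
`R → R′` of local rings with `𝔪_R R′ = 𝔪_{R′}` and an element `a ∈ R` such that every `ℤ`-derivation `D` of `R` has a `ℤ`-derivation `D′` of `R′` with
`D′(a) = D(a)` (read in `R′`): `ℓ_{R′}(R′ ⧸ (D′ a)_{D′}) ≤ ℓ_{R}(R ⧸ (D a)_{D})`. Proof: `(D a)_D · R′ ⊆ (D′ a)_{D′}` (the extensions), the quotient surjection,
`R′ ⧸ J R′ ≅ R′ ⊗_R (R ⧸ J)` (`Algebra.TensorProduct.quotIdealMapEquivTensorQuot`) and Mathlib's flat base change of length
`IsLocalRing.length_baseChange` with `ℓ_{R′}(R′ ⧸ 𝔪_R R′) = ℓ_{R′}(κ(R′)) = 1`. The remaining inputs of `…JacobianLengthEtale` (the completed étale-local map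
`Ŝ → Ŝ′` is flat, local, unramified, and derivations extend along it) are the completion-level facts, filed separately. [cite: Matsumura1987, Thm. 7.1, §25] [folklore]

* `JacobianLength.length_quotient_span_derivation_le_of_flat_unramified`.
-/

noncomputable section

set_option linter.dupNamespace false

open IsLocalRing TensorProduct

namespace Summit.ResolutionOfSingularities.ResolutionOfSingularities.Theorems.SwitchingDichotomy.JacobianLength

/-- **Absolute Jacobian colength along a flat unramified local extension with extendable derivations**: `ℓ_{R′}(R′ ⧸ (D′ a)) ≤ ℓ_{R}(R ⧸ (D a))`.
[cite: Matsumura1987, Thm. 7.1, §25] [folklore] -/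
theorem length_quotient_span_derivation_le_of_flat_unramified {R R' : Type} [CommRing R] [CommRing R'] [IsLocalRing R] [IsLocalRing R']
    [Algebra R R'] [Module.Flat R R'] [IsLocalHom (algebraMap R R')]
    (hunr : (maximalIdeal R).map (algebraMap R R') = maximalIdeal R') (a : R)
    (hext : ∀ D : Derivation ℤ R R, ∃ D' : Derivation ℤ R' R', D' (algebraMap R R' a) = algebraMap R R' (D a)) :
    Module.length R' (R' ⧸ Ideal.span (Set.range fun D' : Derivation ℤ R' R' => D' (algebraMap R R' a))) ≤
      Module.length R (R ⧸ Ideal.span (Set.range fun D : Derivation ℤ R R => D a)) := by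
  classical
  set J : Ideal R := Ideal.span (Set.range fun D : Derivation ℤ R R => D a) with hJ
  set J' : Ideal R' := Ideal.span (Set.range fun D' : Derivation ℤ R' R' => D' (algebraMap R R' a)) with hJ'
  -- `J R′ ⊆ J′`
  have hle : J.map (algebraMap R R') ≤ J' := by
    rw [hJ, Ideal.map_span, Ideal.span_le]
    rintro _ ⟨_, ⟨D, rfl⟩, rfl⟩
    obtain ⟨D', hD'⟩ := hext D
    rw [← hD']
    exact Ideal.subset_span ⟨D', rfl⟩
  -- the quotient surjection `R′ ⧸ J R′ → R′ ⧸ J′`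
  have h1 : Module.length R' (R' ⧸ J') ≤ Module.length R' (R' ⧸ J.map (algebraMap R R')) := by
    refine Module.length_le_of_surjective (Ideal.Quotient.factorₐ R' hle).toLinearMap fun x => ?_
    obtain ⟨r, rfl⟩ := Ideal.Quotient.mk_surjective x
    exact ⟨Ideal.Quotient.mk _ r, rfl⟩
  -- flat base change of length, `ℓ_{R′}(R′ ⧸ 𝔪_R R′) = 1`
  have h2 : Module.length R' (R' ⧸ J.map (algebraMap R R')) = Module.length R (R ⧸ J) := by
    rw [(Algebra.TensorProduct.quotIdealMapEquivTensorQuot R' J).toLinearEquiv.length_eq, IsLocalRing.length_baseChange R R' (R ⧸ J),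
      hunr]
    haveI : IsSimpleModule R' (R' ⧸ maximalIdeal R') :=
      isSimpleModule_iff_quot_maximal.mpr ⟨maximalIdeal R', maximalIdeal.isMaximal R', ⟨LinearEquiv.refl _ _⟩⟩
    rw [Module.length_eq_one R' (R' ⧸ maximalIdeal R'), mul_one]
  exact h1.trans h2.le

end Summit.ResolutionOfSingularities.ResolutionOfSingularities.Theorems.SwitchingDichotomy.JacobianLength

end
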